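import Literature.Probability.LatticeModels.PlaneRotatorComplexRotationBound
import Literature.Probability.LatticeModels.MMPInequality
import HarnessLib

/-!
# The energy-weighted complex-rotation bound for plane rotators with general bond couplings:
# `⟨cos(θ_x − θ_y)⟩_J ≤ e^{−(φ_x−φ_y)} · Z(J^φ)/Z(J) ≤ exp(−(φ_x−φ_y) + ∑_a J_a (cosh(∇φ)_a − 1) ⟨cos(∇θ)_a⟩_{J^φ})`

Topic `Literature/Probability/LatticeModels`. The McBryan–Spencer complex rotation
`θ_v ↦ θ_v + iφ_v` (O. A. McBryan, T. Spencer, Comm. Math. Phys. **53** (1977) 299–302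
[McBryanSpencer1977]; S. Friedli, Y. Velenik, *Statistical Mechanics of Lattice Systems* (CUP 2017),
Thm. 9.12, display (9.23) [FriedliVelenik2017]; tree: `BondSystem.expect_cosDiff_le_exp_cosh`,
`PlaneRotatorComplexRotationBound.lean`) turns the Gibbs weight `exp(∑_a J_a cos(∇θ)_a)` of a plane
rotator into `exp(∑_a J_a cosh(∇φ)_a cos(∇θ)_a)` IN MODULUS — i.e. EXACTLY into the weight of the same
model with the **modulated couplings** `J^φ_a = J_a cosh(φ_{tgt a} − φ_{src a})`. The classical a-priori
step `cos · cosh ≤ cos + (cosh − 1)` then discards the information that the modulation cost is paid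
only through the bond ENERGIES. This file keeps it:

* `BondSystem.partitionFnJ_mul_expectJ_cosDiff_le` — for a finite bond system `G : BondSystem V ι`
  with ARBITRARY real bond couplings `J : ι → ℝ` (Gibbs weight `exp(∑_a J_a cos(θ_{tgt a} − θ_{src a}))`
  on `U(1)^V`, Haar probability), every real `φ : V → ℝ` and all sites `x, y`:
  `Z(J) · ⟨cos(θ_x − θ_y)⟩_J ≤ e^{−(φ_x − φ_y)} · Z(J^φ)` (and the same for `|⟨·⟩|`), an identity of
  entire functions plus ONE triangle inequality — no pointwise bound on the weight;
* `BondSystem.partitionFnJ_le_exp_mul_partitionFnJ` — the classical Peierls–Bogoliubov (Jensen)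
  inequality for the same family: `Z(J') ≤ exp(∑_a (J'_a − J_a) ⟨cos(∇θ)_a⟩_{J'}) · Z(J)` for ANY two
  real coupling arrays (supporting line of `exp` at the mean; no convexity library needed);
* `BondSystem.expectJ_cosDiff_le_exp_energy` — the two combined: **the energy-weighted
  McBryan–Spencer bound**
  `⟨cos(θ_x − θ_y)⟩_J ≤ exp(−(φ_x − φ_y) + ∑_a J_a (cosh(φ_{tgt a} − φ_{src a}) − 1) · ⟨cos(θ_{tgt a} − θ_{src a})⟩_{J^φ})`,
  valid for all real `J`, `φ`; for `J ≥ 0` the bond energies `⟨cos(∇θ)_a⟩_{J^φ} ∈ [0, 1]` replace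
  McBryan–Spencer's factor `1`, and by Ginibre's inequality (tree `ginibreExpect_reChar_mono`) they may be
  evaluated in any uniformly LARGER coupling array `J̄ ≥ J^φ` (`expectJ_cosDiff_le_exp_energy_of_le`),
  e.g. `J̄ = cosh(M) · J` when `|∇φ| ≤ M` on the bonds (`expectJ_cosDiff_le_exp_energy_cosh`).

With `⟨cos(∇θ)_a⟩ ≤ 1` the last display is the tree's `BondSystem.expect_cosDiff_le_exp_cosh`
(`expectJ_cosDiff_le_exp_cosh'` records this for general couplings). The general-coupling Gibbs state
is written as the Ginibre model of the bond characters `θ ↦ θ̄_{src a} θ_{tgt a}` (`bondChar`,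
`weightJ = ginibreWeight`, `expectJ = ginibreExpect`, vocabulary of `GinibreModel.lean`), and
`G.expect β 1 = G.expectJ (fun _ => β)` (`expect_one_eq_expectJ`) bridges to `DisorderedXYModel.lean`.

Use (cell `pub/hubbard-tc`, START-HERE §6 crux №2 «sharp Koma–Tasaki», classical half): this is the
classical mirror of the Peierls–Bogoliubov form of the Koma–Tasaki bound for the Hubbard model
(`Literature.MathematicalPhysics.QuantumLattice.norm_gibbsState_le_of_gauge_peierlsBogoliubov`,
`HubbardPairDecayThermalKinetic.lean`): the cost of the complex gauge rotation is the ENERGY of the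
modulated model, not the coupling norm. The sequel `PlaneRotatorEnergyRenormalizedDecay.lean` bounds the
bond energies of the two-dimensional torus strictly below `1` (equipartition / local Ward identity) and
obtains a power-law exponent strictly larger than the spin-wave value `1/(2πβJ)` of
`torusXY_abs_expect_cosDiff_le_rpow_spinWave`.

## The proof

As in `PlaneRotatorComplexRotationBound.lean`: all spins are rotated at once by the complex angles
`ζ φ_v`; `jRotFn ζ = ∫ θ_x θ̄_y e^{iζ(φ_x−φ_y)} exp(∑_a (J_a/2)(w_a e^{iζδ_a} + w̄_a e^{−iζδ_a})) dθ`
(`w_a = θ̄_{src a} θ_{tgt a}`, `δ_a = φ_{tgt a} − φ_{src a}`) is constant on the real axis (translation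
invariance of the Haar measure), entire (differentiation under the integral sign), hence constant
(identity theorem); at `ζ = 0` its real part is `Z(J)⟨cos(θ_x − θ_y)⟩_J`, and at `ζ = i` the MODULUS of
the integrand is exactly `e^{−(φ_x−φ_y)} exp(∑_a J_a cosh(δ_a) Re w_a)` (`norm_jRotIntegrand_I`).

## References

* O. A. McBryan, T. Spencer, Comm. Math. Phys. 53 (1977) 299–302. [McBryanSpencer1977]
* S. Friedli, Y. Velenik, *Statistical Mechanics of Lattice Systems*, CUP 2017, §9.4, Thm. 9.12,
  display (9.23). [FriedliVelenik2017]
* J. Ginibre, *General formulation of Griffiths' inequalities*, Comm. Math. Phys. 16 (1970) 310–328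
  (monotonicity in the couplings). [Ginibre1970]

Mathlib: `hasDerivAt_integral_of_dominated_loc_of_deriv_le`, `DifferentiableOn.analyticOnNhd`,
`AnalyticOnNhd.eq_of_frequently_eq`, `Real.add_one_le_exp`. Not here: the choice of `φ`, any bound on
the energies, infinite volume.
-/

noncomputable section

open MeasureTheory Finset Filter Complex
open scoped BigOperators ComplexConjugate Topology

namespace Literature.Probability.LatticeModels

namespace BondSystem

variable {V ι : Type*} (G : BondSystem V ι)

/-! ### The general-coupling plane rotator on a bond system as a Ginibre model -/

section Model

/-- `Re(bondChar a θ) = Re Y_a(θ,1) = cos(θ_{tgt a} − θ_{src a})`. [cite: Ginibre1970, Example 4 (plane rotators cos(m·φ), general couplings J_A)] -/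
theorem reChar_bondChar (a : ι) (θ : V → Circle) :
    reChar (G.bondChar a) θ = ((G.bondVar 1 θ a : Circle) : ℂ).re := by
  rw [reChar, bondChar_apply]

/-- The **modulated couplings** `J^φ_a = J_a cosh(φ_{tgt a} − φ_{src a})` produced by the complex
rotation `θ_v ↦ θ_v + iφ_v` (Friedli–Velenik (9.23): `|e^{cos(θ_i + ir_i − θ_j − ir_j)}| =
e^{cosh(r_i − r_j) cos(θ_i − θ_j)}`). [cite: FriedliVelenik2017, Thm 9.12, display before (9.23)] -/
def modCoupling (J : ι → ℝ) (φ : V → ℝ) : ι → ℝ := fun a => J a * Real.cosh (G.bondGrad φ a)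

/-- `J^φ_a = J_a cosh(φ_{tgt a} − φ_{src a})`. [cite: FriedliVelenik2017, Thm 9.12, display (9.23)] -/
@[simp] theorem modCoupling_apply (J : ι → ℝ) (φ : V → ℝ) (a : ι) :
    G.modCoupling J φ a = J a * Real.cosh (φ (G.tgt a) - φ (G.src a)) := rfl

/-- `J ≤ J^φ` for `J ≥ 0` (`cosh ≥ 1`). [cite: FriedliVelenik2017, Thm 9.12, display (9.23)] -/
theorem le_modCoupling {J : ι → ℝ} (hJ : ∀ a, 0 ≤ J a) (φ : V → ℝ) (a : ι) :
    J a ≤ G.modCoupling J φ a := by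
  rw [modCoupling_apply]
  exact le_mul_of_one_le_right (hJ a) (Real.one_le_cosh _)

/-- `J^φ ≤ cosh(M) · J` when `J ≥ 0` and `|φ_{tgt a} − φ_{src a}| ≤ M` on every bond. [cite: FriedliVelenik2017, Thm 9.12, display (9.23)] -/
theorem modCoupling_le_cosh_mul {J : ι → ℝ} (hJ : ∀ a, 0 ≤ J a) {φ : V → ℝ} {M : ℝ}
    (hM : ∀ a, |φ (G.tgt a) - φ (G.src a)| ≤ M) (a : ι) :
    G.modCoupling J φ a ≤ Real.cosh M * J a := by
  rw [modCoupling_apply, mul_comm]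
  refine mul_le_mul_of_nonneg_right ?_ (hJ a)
  rw [← Real.cosh_abs]
  exact Real.cosh_le_cosh.2 (by rw [abs_abs, abs_of_nonneg ((abs_nonneg _).trans (hM a))]; exact hM a)

variable [Fintype ι]

/-- The Gibbs weight `exp(∑_a J_a cos(θ_{tgt a} − θ_{src a}))` of the plane rotator on the bond
system `G` with GENERAL real bond couplings `J : ι → ℝ` (the Ginibre weight of the bond characters;
inverse temperature absorbed in `J`). [cite: Ginibre1970, Example 4 (plane rotators)] -/
def weightJ (J : ι → ℝ) (θ : V → Circle) : ℝ :=
  ginibreWeight G.bondChar J θ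

/-- The weight in coordinates: `weightJ J θ = exp(∑_a J_a Re Y_a(θ,1))`. [cite: Ginibre1970, Example 4 (plane rotators cos(m·φ), general couplings J_A)] -/
theorem weightJ_eq_exp (J : ι → ℝ) (θ : V → Circle) :
    G.weightJ J θ = Real.exp (∑ a, J a * ((G.bondVar 1 θ a : Circle) : ℂ).re) := by
  simp only [weightJ, ginibreWeight, ginibreHamiltonian, reChar_bondChar]

/-- The weight is positive. [cite: Ginibre1970, Example 4 (plane rotators cos(m·φ), general couplings J_A)] -/
theorem weightJ_pos (J : ι → ℝ) (θ : V → Circle) : 0 < G.weightJ J θ := by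
  rw [weightJ_eq_exp]; exact Real.exp_pos _

/-- The weight is continuous in the spins. [cite: Ginibre1970, Example 4 (plane rotators cos(m·φ), general couplings J_A)] -/
theorem continuous_weightJ (J : ι → ℝ) : Continuous (G.weightJ J) :=
  continuous_ginibreWeight _ _

/-- Additivity of the weight in the couplings: `w_{J+K} = w_J · w_K`. [cite: Ginibre1970, Example 4 (plane rotators cos(m·φ), general couplings J_A)] -/
theorem weightJ_add (J K : ι → ℝ) (θ : V → Circle) :
    G.weightJ (J + K) θ = G.weightJ J θ * G.weightJ K θ :=
  ginibreWeight_add _ _ _ _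

/-- With all couplings equal to `β` the general weight is the weight `exp(β ∑_a cos)` of
`DisorderedXYModel.lean` without phases. [cite: GarbanSpencer2022, (1.1)] -/
theorem weight_one_eq_weightJ (β : ℝ) (θ : V → Circle) :
    G.weight β 1 θ = G.weightJ (fun _ => β) θ := by
  rw [weight, weightJ_eq_exp, energy, Finset.mul_sum]

variable [Fintype V] [MeasurableSpace Circle] [BorelSpace Circle]

/-- The partition function `Z(J) = ∫ exp(∑_a J_a cos(θ_{tgt a} − θ_{src a})) dθ` (Haar probability
measure of `U(1)^V`). [cite: Ginibre1970, Example 4 (plane rotators cos(m·φ), general couplings J_A)] -/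
def partitionFnJ (J : ι → ℝ) : ℝ :=
  ∫ θ, G.weightJ J θ ∂torusHaar V

/-- The Gibbs expectation `⟨f⟩_J = ∫ f w_J / ∫ w_J` with general bond couplings (the Ginibre
expectation of the bond characters). [cite: Ginibre1970, Example 4 (plane rotators)] -/
def expectJ (J : ι → ℝ) (f : (V → Circle) → ℝ) : ℝ :=
  ginibreExpect (torusHaar V) G.bondChar J f

/-- `⟨f⟩_J = (∫ f w_J) / Z(J)`. [cite: Ginibre1970, Example 4 (plane rotators cos(m·φ), general couplings J_A)] -/
theorem expectJ_eq (J : ι → ℝ) (f : (V → Circle) → ℝ) :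
    G.expectJ J f = (∫ θ, f θ * G.weightJ J θ ∂torusHaar V) / G.partitionFnJ J := rfl

/-- The weight is integrable. [cite: Ginibre1970, Example 4 (plane rotators cos(m·φ), general couplings J_A)] -/
theorem integrable_weightJ (J : ι → ℝ) : Integrable (G.weightJ J) (torusHaar V) :=
  integrable_torusHaar_of_continuous (G.continuous_weightJ J)

/-- `Z(J) > 0`. [cite: Ginibre1970, Example 4 (plane rotators cos(m·φ), general couplings J_A)] -/
theorem partitionFnJ_pos (J : ι → ℝ) : 0 < G.partitionFnJ J :=
  integral_exp_pos (G.integrable_weightJ J)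

/-- Bridge to `DisorderedXYModel.lean`: `Z_β = Z(β, …, β)`. [cite: GarbanSpencer2022, (1.1)] -/
theorem partitionFn_one_eq_partitionFnJ (β : ℝ) : G.partitionFn β 1 = G.partitionFnJ (fun _ => β) := by
  simp only [partitionFn, partitionFnJ, weight_one_eq_weightJ]

/-- Bridge to `DisorderedXYModel.lean`: `⟨f⟩_β = ⟨f⟩_{(β, …, β)}`. [cite: GarbanSpencer2022, (1.1)] -/
theorem expect_one_eq_expectJ (β : ℝ) (f : (V → Circle) → ℝ) :
    G.expect β 1 f = G.expectJ (fun _ => β) f := by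
  simp only [expect, expectJ_eq, partitionFn_one_eq_partitionFnJ, weight_one_eq_weightJ]

/-- Expectations of continuous observables bounded by `1` are at most `1`. [cite: Ginibre1970, Example 4 (plane rotators cos(m·φ), general couplings J_A)] -/
theorem expectJ_le_one {J : ι → ℝ} {f : (V → Circle) → ℝ} (hf : Continuous f) (hf1 : ∀ θ, f θ ≤ 1) :
    G.expectJ J f ≤ 1 := by
  rw [expectJ_eq, div_le_one (G.partitionFnJ_pos J), partitionFnJ]
  refine integral_mono (integrable_torusHaar_of_continuous (hf.mul (G.continuous_weightJ J)))
    (G.integrable_weightJ J) fun θ => ?_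
  have hw := (G.weightJ_pos J θ).le
  have h1 := hf1 θ
  nlinarith

/-- The bond energy `⟨cos(θ_{tgt a} − θ_{src a})⟩_J` is at most `1` (any real couplings). [cite: Ginibre1970, Example 4 (plane rotators cos(m·φ), general couplings J_A)] -/
theorem expectJ_reChar_bondChar_le_one (J : ι → ℝ) (a : ι) :
    G.expectJ J (reChar (G.bondChar a)) ≤ 1 :=
  G.expectJ_le_one (continuous_reChar _) fun _ => (le_abs_self _).trans (abs_reChar_le_one _ _)

/-- Griffiths–Ginibre monotonicity of the bond energies in the couplings: `0 ≤ J ≤ J'` ⇒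
`⟨cos(∇θ)_a⟩_J ≤ ⟨cos(∇θ)_a⟩_{J'}` (tree `ginibreExpect_reChar_mono`). [cite: Ginibre1970, Prop. 3 with Example 4 (plane rotators)] -/
theorem expectJ_reChar_mono {J J' : ι → ℝ} (hJ : ∀ a, 0 ≤ J a) (hJJ' : ∀ a, J a ≤ J' a)
    (χ₀ : (V → Circle) →ₜ* Circle) :
    G.expectJ J (reChar χ₀) ≤ G.expectJ J' (reChar χ₀) :=
  ginibreExpect_reChar_mono _ surjective_mul_self_torus _ _ hJ hJJ'

end Model

/-! ### The complex rotation with general couplings -/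

section Rotation

variable [Fintype ι] (J : ι → ℝ) (φ : V → ℝ) (x y : V)

/-- `I · c · I = −c`. [folklore] -/
private theorem I_mul_ofReal_mul_I' (c : ℝ) : I * (c : ℂ) * I = -(c : ℂ) := by
  rw [mul_right_comm, I_mul_I, neg_one_mul]

/-- The spin at `v` of the rotated configuration: `θ_v e^{iτφ_v}`. [folklore] -/
private theorem coe_mul_twistField' (θ : V → Circle) (τ : ℝ) (v : V) :
    (((θ * twistField φ τ) v : Circle) : ℂ) = ((θ v : Circle) : ℂ) * cexp (((τ * φ v : ℝ) : ℂ) * I) := by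
  rw [Pi.mul_apply, Circle.coe_mul, twistField, Circle.coe_exp]

omit [Fintype ι] in
/-- The bond variable of the rotated configuration: `w_a(θ e^{iτφ}) = w_a(θ) e^{iτδ_a}`. [folklore] -/
private theorem coe_bondVar_one_mul_twistField' (θ : V → Circle) (τ : ℝ) (a : ι) :
    ((G.bondVar 1 (θ * twistField φ τ) a : Circle) : ℂ) =
      ((G.bondVar 1 θ a : Circle) : ℂ) * cexp (I * ((G.bondGrad φ a : ℝ) : ℂ) * (τ : ℂ)) := by
  have key : cexp (-(((τ * φ (G.src a) : ℝ) : ℂ) * I)) * cexp (((τ * φ (G.tgt a) : ℝ) : ℂ) * I) =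
      cexp (I * ((G.bondGrad φ a : ℝ) : ℂ) * (τ : ℂ)) := by
    rw [← Complex.exp_add]; congr 1; unfold bondGrad; push_cast; ring
  simp only [bondVar_one, Circle.coe_mul, Circle.coe_inv_eq_conj, coe_mul_twistField', map_mul,
    ← Complex.exp_conj, Complex.conj_ofReal, Complex.conj_I, mul_neg]
  linear_combination (conj ((θ (G.src a) : Circle) : ℂ) * ((θ (G.tgt a) : Circle) : ℂ)) * key

/-- The exponent of the rotated integrand with general couplings:
`E(ζ, θ) = iζ(φ_x − φ_y) + ∑_a (J_a/2)(w_a e^{iζδ_a} + w̄_a e^{−iζδ_a})`.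
[cite: FriedliVelenik2017, Thm 9.12, display (9.23)] -/
def jRotExponent (ζ : ℂ) (θ : V → Circle) : ℂ :=
  I * ((φ x - φ y : ℝ) : ℂ) * ζ +
    ∑ a, ((J a / 2 : ℝ) : ℂ) * (((G.bondVar 1 θ a : Circle) : ℂ) * cexp (I * ((G.bondGrad φ a : ℝ) : ℂ) * ζ) +
      conj ((G.bondVar 1 θ a : Circle) : ℂ) * cexp (-(I * ((G.bondGrad φ a : ℝ) : ℂ) * ζ)))

/-- The `ζ`-derivative of the exponent. [folklore] -/
def jRotExponentDeriv (ζ : ℂ) (θ : V → Circle) : ℂ :=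
  I * ((φ x - φ y : ℝ) : ℂ) +
    ∑ a, ((J a / 2 : ℝ) : ℂ) * (((G.bondVar 1 θ a : Circle) : ℂ) *
        (cexp (I * ((G.bondGrad φ a : ℝ) : ℂ) * ζ) * (I * ((G.bondGrad φ a : ℝ) : ℂ))) +
      conj ((G.bondVar 1 θ a : Circle) : ℂ) *
        (cexp (-(I * ((G.bondGrad φ a : ℝ) : ℂ) * ζ)) * (-(I * ((G.bondGrad φ a : ℝ) : ℂ)))))

/-- The rotated integrand `θ_x θ̄_y · exp E(ζ, θ)`. [cite: FriedliVelenik2017, Thm 9.12, display (9.23)] -/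
def jRotIntegrand (ζ : ℂ) (θ : V → Circle) : ℂ :=
  ((θ x : Circle) : ℂ) * conj ((θ y : Circle) : ℂ) * cexp (G.jRotExponent J φ x y ζ θ)

/-- The `ζ`-derivative of the rotated integrand. [folklore] -/
def jRotIntegrandDeriv (ζ : ℂ) (θ : V → Circle) : ℂ :=
  ((θ x : Circle) : ℂ) * conj ((θ y : Circle) : ℂ) *
    (cexp (G.jRotExponent J φ x y ζ θ) * G.jRotExponentDeriv J φ x y ζ θ)

/-- The exponent is jointly continuous in `(ζ, θ)`. [folklore] -/
private theorem continuous_jRotExponent :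
    Continuous fun p : ℂ × (V → Circle) => G.jRotExponent J φ x y p.1 p.2 := by
  unfold jRotExponent
  have hw : ∀ a, Continuous fun p : ℂ × (V → Circle) => ((G.bondVar 1 p.2 a : Circle) : ℂ) := fun a =>
    continuous_subtype_val.comp ((G.continuous_bondVar 1 a).comp continuous_snd)
  fun_prop

/-- The derivative of the exponent is jointly continuous in `(ζ, θ)`. [folklore] -/
private theorem continuous_jRotExponentDeriv :
    Continuous fun p : ℂ × (V → Circle) => G.jRotExponentDeriv J φ x y p.1 p.2 := by
  unfold jRotExponentDeriv
  have hw : ∀ a, Continuous fun p : ℂ × (V → Circle) => ((G.bondVar 1 p.2 a : Circle) : ℂ) := fun a =>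
    continuous_subtype_val.comp ((G.continuous_bondVar 1 a).comp continuous_snd)
  fun_prop

/-- The rotated integrand is jointly continuous in `(ζ, θ)`. [folklore] -/
private theorem continuous_jRotIntegrand :
    Continuous fun p : ℂ × (V → Circle) => G.jRotIntegrand J φ x y p.1 p.2 := by
  unfold jRotIntegrand
  have hx : Continuous fun p : ℂ × (V → Circle) => ((p.2 x : Circle) : ℂ) :=
    continuous_subtype_val.comp ((continuous_apply x).comp continuous_snd)
  have hy : Continuous fun p : ℂ × (V → Circle) => ((p.2 y : Circle) : ℂ) :=
    continuous_subtype_val.comp ((continuous_apply y).comp continuous_snd)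
  have hE := G.continuous_jRotExponent J φ x y
  fun_prop

/-- The derivative of the rotated integrand is jointly continuous in `(ζ, θ)`. [folklore] -/
private theorem continuous_jRotIntegrandDeriv :
    Continuous fun p : ℂ × (V → Circle) => G.jRotIntegrandDeriv J φ x y p.1 p.2 := by
  unfold jRotIntegrandDeriv
  have hx : Continuous fun p : ℂ × (V → Circle) => ((p.2 x : Circle) : ℂ) :=
    continuous_subtype_val.comp ((continuous_apply x).comp continuous_snd)
  have hy : Continuous fun p : ℂ × (V → Circle) => ((p.2 y : Circle) : ℂ) :=
    continuous_subtype_val.comp ((continuous_apply y).comp continuous_snd)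
  have hE := G.continuous_jRotExponent J φ x y
  have hE' := G.continuous_jRotExponentDeriv J φ x y
  fun_prop

/-- `ζ ↦ c ζ` has derivative `c`. [folklore] -/
private theorem hasDerivAt_const_mul' (c ζ : ℂ) : HasDerivAt (fun z : ℂ => c * z) c ζ := by
  simpa using (hasDerivAt_id ζ).const_mul c

/-- The exponent is entire in `ζ` with the stated derivative. [folklore] -/
private theorem hasDerivAt_jRotExponent (θ : V → Circle) (ζ : ℂ) :
    HasDerivAt (fun z => G.jRotExponent J φ x y z θ) (G.jRotExponentDeriv J φ x y ζ θ) ζ := by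
  unfold jRotExponent jRotExponentDeriv
  refine (hasDerivAt_const_mul' _ ζ).add (HasDerivAt.fun_sum fun a _ => ?_)
  refine HasDerivAt.const_mul _ ((HasDerivAt.const_mul _ ?_).add (HasDerivAt.const_mul _ ?_))
  · exact (hasDerivAt_const_mul' _ ζ).cexp
  · exact (hasDerivAt_const_mul' _ ζ).fun_neg.cexp

/-- The rotated integrand is entire in `ζ` with the stated derivative. [folklore] -/
private theorem hasDerivAt_jRotIntegrand (θ : V → Circle) (ζ : ℂ) :
    HasDerivAt (fun z => G.jRotIntegrand J φ x y z θ) (G.jRotIntegrandDeriv J φ x y ζ θ) ζ := by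
  unfold jRotIntegrand jRotIntegrandDeriv
  exact ((G.hasDerivAt_jRotExponent J φ x y θ ζ).cexp).const_mul _

/-- For real `ζ = τ` the rotated integrand is the un-rotated integrand of the configuration rotated by
`(e^{iτφ_v})_v`. [cite: FriedliVelenik2017, Thm 9.12, proof (periodicity of the integrand)] -/
theorem jRotIntegrand_ofReal (θ : V → Circle) (τ : ℝ) :
    G.jRotIntegrand J φ x y (τ : ℂ) θ = G.jRotIntegrand J φ x y 0 (θ * twistField φ τ) := by
  have key : cexp (I * ((φ x - φ y : ℝ) : ℂ) * (τ : ℂ)) =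
      cexp (((τ * φ x : ℝ) : ℂ) * I) * cexp (-(((τ * φ y : ℝ) : ℂ) * I)) := by
    rw [← Complex.exp_add]; congr 1; push_cast; ring
  unfold jRotIntegrand jRotExponent
  simp only [coe_bondVar_one_mul_twistField', coe_mul_twistField', map_mul, mul_zero, neg_zero,
    Complex.exp_zero, mul_one, zero_add, ← Complex.exp_conj, Complex.conj_ofReal, Complex.conj_I, mul_neg,
    neg_mul, Complex.exp_add, key]
  ring

/-- The real part of the exponent at `ζ = i` is EXACTLY the modulated energy:
`Re E(i, θ) = −(φ_x − φ_y) + ∑_a J_a cosh(δ_a) Re w_a(θ)`.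
[cite: FriedliVelenik2017, Thm 9.12, display before (9.23)] -/
theorem jRotExponent_I_re (θ : V → Circle) :
    (G.jRotExponent J φ x y I θ).re =
      -(φ x - φ y) + ∑ a, G.modCoupling J φ a * ((G.bondVar 1 θ a : Circle) : ℂ).re := by
  unfold jRotExponent
  have hexp : ∀ a, cexp (I * ((G.bondGrad φ a : ℝ) : ℂ) * I) = ((Real.exp (-G.bondGrad φ a) : ℝ) : ℂ) := by
    intro a; rw [I_mul_ofReal_mul_I', Complex.ofReal_exp, Complex.ofReal_neg]
  have hexp' : ∀ a, cexp (-(I * ((G.bondGrad φ a : ℝ) : ℂ) * I)) = ((Real.exp (G.bondGrad φ a) : ℝ) : ℂ) := by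
    intro a; rw [I_mul_ofReal_mul_I', neg_neg, Complex.ofReal_exp]
  simp_rw [hexp, hexp', I_mul_ofReal_mul_I']
  rw [Complex.add_re, Complex.neg_re, Complex.ofReal_re, Complex.re_sum]
  congr 1
  refine Finset.sum_congr rfl fun a _ => ?_
  rw [Complex.re_ofReal_mul, Complex.add_re, Complex.mul_re, Complex.mul_re, Complex.ofReal_re,
    Complex.ofReal_im, Complex.ofReal_re, Complex.ofReal_im, Complex.conj_re, Complex.conj_im,
    modCoupling, Real.cosh_eq]
  ring

/-- The exponent at `ζ = 0` is the un-rotated (negative) Hamiltonian `∑_a J_a Re w_a`. [folklore] -/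
private theorem jRotExponent_zero (θ : V → Circle) :
    G.jRotExponent J φ x y 0 θ = ((∑ a, J a * ((G.bondVar 1 θ a : Circle) : ℂ).re : ℝ) : ℂ) := by
  unfold jRotExponent
  simp only [mul_zero, neg_zero, Complex.exp_zero, mul_one, zero_add, Complex.add_conj]
  push_cast
  refine Finset.sum_congr rfl fun a _ => ?_
  ring

/-- **The modulus of the rotated integrand at `ζ = i` is the modulated Gibbs weight**:
`|θ_x θ̄_y exp E(i, θ)| = e^{−(φ_x−φ_y)} · exp(∑_a J_a cosh(δ_a) cos(θ_{tgt a} − θ_{src a}))` — an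
EQUALITY (Friedli–Velenik (9.23) before the step `cos · cosh ≤ cos + cosh − 1`).
[cite: FriedliVelenik2017, Thm 9.12, display (9.23)] -/
theorem norm_jRotIntegrand_I (θ : V → Circle) :
    ‖G.jRotIntegrand J φ x y I θ‖ = Real.exp (-(φ x - φ y)) * G.weightJ (G.modCoupling J φ) θ := by
  rw [jRotIntegrand, norm_mul, norm_mul, Complex.norm_conj, Circle.norm_coe, Circle.norm_coe,
    one_mul, one_mul, Complex.norm_exp, jRotExponent_I_re, Real.exp_add, weightJ_eq_exp]

/-- The un-rotated integrand is `θ_x θ̄_y` times the Gibbs weight `w_J`. [folklore] -/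
private theorem jRotIntegrand_zero (θ : V → Circle) :
    G.jRotIntegrand J φ x y 0 θ = ((θ x : Circle) : ℂ) * conj ((θ y : Circle) : ℂ) * ((G.weightJ J θ : ℝ) : ℂ) := by
  rw [jRotIntegrand, jRotExponent_zero, weightJ_eq_exp, Complex.ofReal_exp]

end Rotation

/-! ### The rotated integral as an entire function -/

section Function

variable [Fintype V] [Fintype ι] [MeasurableSpace Circle] [BorelSpace Circle]
  (J : ι → ℝ) (φ : V → ℝ) (x y : V)

/-- The rotated integral `ζ ↦ ∫ θ_x θ̄_y exp E(ζ, θ) dθ`. [cite: FriedliVelenik2017, Thm 9.12, display (9.23)] -/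
def jRotFn (ζ : ℂ) : ℂ :=
  ∫ θ, G.jRotIntegrand J φ x y ζ θ ∂torusHaar V

/-- Invariance under real rotations (translation invariance of the Haar measure of `U(1)^V`).
[cite: FriedliVelenik2017, Thm 9.12, proof (periodicity of the integrand)] -/
theorem jRotFn_ofReal (τ : ℝ) : G.jRotFn J φ x y (τ : ℂ) = G.jRotFn J φ x y 0 := by
  unfold jRotFn
  simp_rw [jRotIntegrand_ofReal]
  exact integral_torusHaar_mul_right (fun θ => G.jRotIntegrand J φ x y 0 θ) (twistField φ τ)

/-- Differentiation under the integral sign: the rotated integral is complex-differentiable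
everywhere. [folklore] -/
private theorem hasDerivAt_jRotFn (ζ₀ : ℂ) :
    HasDerivAt (G.jRotFn J φ x y) (∫ θ, G.jRotIntegrandDeriv J φ x y ζ₀ θ ∂torusHaar V) ζ₀ := by
  have hF := G.continuous_jRotIntegrand J φ x y
  have hF' := G.continuous_jRotIntegrandDeriv J φ x y
  have hFζ : ∀ ζ, Continuous fun θ : V → Circle => G.jRotIntegrand J φ x y ζ θ := fun ζ =>
    hF.comp (continuous_const.prodMk continuous_id)
  have hF'ζ : ∀ ζ, Continuous fun θ : V → Circle => G.jRotIntegrandDeriv J φ x y ζ θ := fun ζ =>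
    hF'.comp (continuous_const.prodMk continuous_id)
  obtain ⟨C, hC⟩ := ((isCompact_closedBall ζ₀ 1).prod isCompact_univ).exists_bound_of_continuousOn
    hF'.continuousOn
  have h := hasDerivAt_integral_of_dominated_loc_of_deriv_le (μ := torusHaar V)
    (F := fun ζ θ => G.jRotIntegrand J φ x y ζ θ)
    (F' := fun ζ θ => G.jRotIntegrandDeriv J φ x y ζ θ) (x₀ := ζ₀)
    (s := Metric.ball ζ₀ 1) (bound := fun _ => C) (Metric.ball_mem_nhds ζ₀ one_pos)
    (Eventually.of_forall fun ζ => (hFζ ζ).aestronglyMeasurable)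
    (integrable_torusHaar_of_continuous (hFζ ζ₀)) (hF'ζ ζ₀).aestronglyMeasurable
    (ae_of_all _ fun θ ζ hζ => hC (ζ, θ) (Set.mk_mem_prod (Metric.ball_subset_closedBall hζ) (Set.mem_univ θ)))
    (integrable_const C)
    (ae_of_all _ fun θ ζ _ => G.hasDerivAt_jRotIntegrand J φ x y θ ζ)
  exact h.2

/-- **The complex rotation does not change the integral**: `jRotFn` is constant on the real axis and
entire, hence constant; in particular its value at `ζ = i` equals its value at `ζ = 0`.
[cite: FriedliVelenik2017, Thm 9.12, proof (contour shift, Fig. 9.5)] -/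
theorem jRotFn_I : G.jRotFn J φ x y I = G.jRotFn J φ x y 0 := by
  have hdiff : Differentiable ℂ (G.jRotFn J φ x y) := fun ζ => (G.hasDerivAt_jRotFn J φ x y ζ).differentiableAt
  have hana : AnalyticOnNhd ℂ (G.jRotFn J φ x y) Set.univ := hdiff.differentiableOn.analyticOnNhd isOpen_univ
  have hconst : AnalyticOnNhd ℂ (fun _ : ℂ => G.jRotFn J φ x y 0) Set.univ := analyticOnNhd_const
  have ht : Tendsto (fun n : ℕ => (((1 / ((n : ℝ) + 1) : ℝ)) : ℂ)) atTop (𝓝[≠] (0 : ℂ)) := by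
    refine tendsto_nhdsWithin_iff.2 ⟨?_, Eventually.of_forall fun n => ?_⟩
    · have h0 : Tendsto (fun n : ℕ => (((1 / ((n : ℝ) + 1) : ℝ)) : ℂ)) atTop (𝓝 (((0 : ℝ)) : ℂ)) :=
        (Complex.continuous_ofReal.tendsto (0 : ℝ)).comp tendsto_one_div_add_atTop_nhds_zero_nat
      rwa [Complex.ofReal_zero] at h0
    · rw [Set.mem_compl_iff, Set.mem_singleton_iff, ofReal_eq_zero]
      exact (by positivity : (0 : ℝ) < 1 / ((n : ℝ) + 1)).ne'
  have hfreq : ∃ᶠ z in 𝓝[≠] (0 : ℂ), G.jRotFn J φ x y z = G.jRotFn J φ x y 0 :=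
    ht.frequently (Frequently.of_forall fun n => G.jRotFn_ofReal J φ x y _)
  exact congrFun (hana.eq_of_frequently_eq hconst hfreq) I

/-- The real part of the un-rotated integral is `Z(J) · ⟨cos(θ_x − θ_y)⟩_J = ∫ cos(θ_x − θ_y) w_J`.
[folklore] -/
private theorem jRotFn_zero_re :
    (G.jRotFn J φ x y 0).re = ∫ θ, cosDiff x y θ * G.weightJ J θ ∂torusHaar V := by
  unfold jRotFn
  have hc : Continuous fun θ : V → Circle => G.jRotIntegrand J φ x y 0 θ :=
    (G.continuous_jRotIntegrand J φ x y).comp (continuous_const.prodMk continuous_id)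
  have h := integral_re (integrable_torusHaar_of_continuous hc)
  simp only [RCLike.re_to_complex] at h
  rw [← h]
  refine integral_congr_ae (ae_of_all _ fun θ => ?_)
  dsimp only
  rw [jRotIntegrand_zero, Complex.re_mul_ofReal]
  congr 1
  rw [cosDiff, Complex.mul_re, Complex.mul_re, Complex.conj_re, Complex.conj_im, Complex.conj_re,
    Complex.conj_im]
  ring

/-! ### The energy-weighted McBryan–Spencer bound -/

/-- **Complex rotation with the modulated partition function.** For every finite bond system, all real
couplings `J`, every real `φ` and all `x, y`:
`Z(J) · ⟨cos(θ_x − θ_y)⟩_J ≤ e^{−(φ_x − φ_y)} · Z(J^φ)`, `J^φ_a = J_a cosh(φ_{tgt a} − φ_{src a})`.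
[cite: McBryanSpencer1977, main theorem (proof: complex rotation)] -/
theorem partitionFnJ_mul_expectJ_cosDiff_le :
    G.partitionFnJ J * G.expectJ J (cosDiff x y) ≤
      Real.exp (-(φ x - φ y)) * G.partitionFnJ (G.modCoupling J φ) := by
  have hZ := G.partitionFnJ_pos J
  rw [expectJ_eq, mul_div_cancel₀ _ hZ.ne']
  calc ∫ θ, cosDiff x y θ * G.weightJ J θ ∂torusHaar V
      = (G.jRotFn J φ x y 0).re := (G.jRotFn_zero_re J φ x y).symm
    _ = (G.jRotFn J φ x y I).re := by rw [jRotFn_I]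
    _ ≤ ‖G.jRotFn J φ x y I‖ := Complex.re_le_norm _
    _ ≤ ∫ θ, ‖G.jRotIntegrand J φ x y I θ‖ ∂torusHaar V := norm_integral_le_integral_norm _
    _ = Real.exp (-(φ x - φ y)) * G.partitionFnJ (G.modCoupling J φ) := by
        simp_rw [norm_jRotIntegrand_I]
        rw [integral_const_mul]; rfl

/-- The same for the absolute value: `Z(J) · |⟨cos(θ_x − θ_y)⟩_J| ≤ e^{−(φ_x − φ_y)} · Z(J^φ)`.
[cite: McBryanSpencer1977, main theorem (proof: complex rotation)] -/
theorem partitionFnJ_mul_abs_expectJ_cosDiff_le :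
    G.partitionFnJ J * |G.expectJ J (cosDiff x y)| ≤
      Real.exp (-(φ x - φ y)) * G.partitionFnJ (G.modCoupling J φ) := by
  have hZ := G.partitionFnJ_pos J
  rw [expectJ_eq, abs_div, abs_of_pos hZ, mul_div_cancel₀ _ hZ.ne']
  calc |∫ θ, cosDiff x y θ * G.weightJ J θ ∂torusHaar V|
      = |(G.jRotFn J φ x y I).re| := by rw [jRotFn_I, jRotFn_zero_re]
    _ ≤ ‖G.jRotFn J φ x y I‖ := Complex.abs_re_le_norm _
    _ ≤ ∫ θ, ‖G.jRotIntegrand J φ x y I θ‖ ∂torusHaar V := norm_integral_le_integral_norm _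
    _ = Real.exp (-(φ x - φ y)) * G.partitionFnJ (G.modCoupling J φ) := by
        simp_rw [norm_jRotIntegrand_I]
        rw [integral_const_mul]; rfl

/-! ### The classical Peierls–Bogoliubov (Jensen) inequality for the coupling family -/

/-- `⟨f⟩_J · Z(J) = ∫ f w_J`. [cite: Ginibre1970, Example 4 (plane rotators cos(m·φ), general couplings J_A)] -/
theorem expectJ_mul_partitionFnJ (J' : ι → ℝ) (f : (V → Circle) → ℝ) :
    G.expectJ J' f * G.partitionFnJ J' = ∫ θ, f θ * G.weightJ J' θ ∂torusHaar V := by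
  rw [expectJ_eq, div_mul_cancel₀ _ (G.partitionFnJ_pos J').ne']

/-- Linearity: `∑_a c_a ⟨Re w_a⟩_{J'} · Z(J') = ∫ (∑_a c_a Re w_a) w_{J'}`. [folklore] -/
private theorem sum_mul_expectJ_mul_partitionFnJ (J' : ι → ℝ) (c : ι → ℝ) :
    (∑ a, c a * G.expectJ J' (reChar (G.bondChar a))) * G.partitionFnJ J' =
      ∫ θ, (∑ a, c a * reChar (G.bondChar a) θ) * G.weightJ J' θ ∂torusHaar V := by
  have hi : ∀ a ∈ (univ : Finset ι),
      Integrable (fun θ => c a * (reChar (G.bondChar a) θ * G.weightJ J' θ)) (torusHaar V) := fun a _ =>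
    integrable_torusHaar_of_continuous
      (continuous_const.mul ((continuous_reChar _).mul (G.continuous_weightJ J')))
  calc (∑ a, c a * G.expectJ J' (reChar (G.bondChar a))) * G.partitionFnJ J'
      = ∑ a, c a * (G.expectJ J' (reChar (G.bondChar a)) * G.partitionFnJ J') := by
        rw [Finset.sum_mul]; simp only [mul_assoc]
    _ = ∑ a, ∫ θ, c a * (reChar (G.bondChar a) θ * G.weightJ J' θ) ∂torusHaar V := by
        simp_rw [expectJ_mul_partitionFnJ, ← integral_const_mul]
    _ = ∫ θ, ∑ a, c a * (reChar (G.bondChar a) θ * G.weightJ J' θ) ∂torusHaar V :=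
        (integral_finsetSum _ hi).symm
    _ = _ := integral_congr_ae (ae_of_all _ fun θ => by simp only [Finset.sum_mul, mul_assoc])

/-- **Peierls–Bogoliubov / Jensen for the coupling family.** For ANY two real coupling arrays `J, J'`
on the same bond system: `Z(J') ≤ exp(∑_a (J'_a − J_a) ⟨cos(θ_{tgt a} − θ_{src a})⟩_{J'}) · Z(J)`
(`Z(J)/Z(J') = ⟨e^{−X}⟩_{J'} ≥ e^{−⟨X⟩_{J'}}`, `X = ∑_a (J'_a − J_a) Re w_a`, by the supporting line of
`exp` at the mean). [cite: FriedliVelenik2017, §3.10.2, proof of Thm 3.53 (Jensen: Z ≥ Z⁰·exp(−⟨H¹⟩⁰))] -/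
theorem partitionFnJ_le_exp_mul_partitionFnJ (J' : ι → ℝ) :
    G.partitionFnJ J' ≤
      Real.exp (∑ a, (J' a - J a) * G.expectJ J' (reChar (G.bondChar a))) * G.partitionFnJ J := by
  set m : ℝ := ∑ a, (J' a - J a) * G.expectJ J' (reChar (G.bondChar a)) with hm
  set X : (V → Circle) → ℝ := fun θ => ∑ a, (J' a - J a) * reChar (G.bondChar a) θ with hX
  have hZ' := G.partitionFnJ_pos J'
  have hXc : Continuous X := continuous_finsetSum _ fun a _ => continuous_const.mul (continuous_reChar _)
  -- `m · Z(J') = ∫ X w_{J'}`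
  have hmean : m * G.partitionFnJ J' = ∫ θ, X θ * G.weightJ J' θ ∂torusHaar V :=
    G.sum_mul_expectJ_mul_partitionFnJ J' _
  -- `w_J = e^{−X} w_{J'}`
  have hw : ∀ θ, G.weightJ J θ = Real.exp (-X θ) * G.weightJ J' θ := by
    intro θ
    have hJ : J = (J - J') + J' := by simp
    rw [hJ, G.weightJ_add, weightJ, ginibreWeight, ginibreHamiltonian]
    congr 2
    simp only [hX, Pi.sub_apply, ← Finset.sum_neg_distrib]
    exact Finset.sum_congr rfl fun a _ => by ring
  -- supporting line: `e^{−X} ≥ e^{−m}(1 + m − X)`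
  have hline : ∀ θ, Real.exp (-m) * ((1 + m - X θ) * G.weightJ J' θ) ≤ G.weightJ J θ := by
    intro θ
    rw [hw θ, ← mul_assoc]
    refine mul_le_mul_of_nonneg_right ?_ (G.weightJ_pos J' θ).le
    have h1 : m - X θ + 1 ≤ Real.exp (m - X θ) := Real.add_one_le_exp _
    have h2 : Real.exp (-m) * Real.exp (m - X θ) = Real.exp (-X θ) := by
      rw [← Real.exp_add]; congr 1; ring
    rw [← h2]
    exact mul_le_mul_of_nonneg_left (by linarith) (Real.exp_pos _).le
  have hi1 : Integrable (fun θ => (1 + m - X θ) * G.weightJ J' θ) (torusHaar V) :=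
    integrable_torusHaar_of_continuous ((continuous_const.sub hXc).mul (G.continuous_weightJ J'))
  have hint : Real.exp (-m) * ∫ θ, (1 + m - X θ) * G.weightJ J' θ ∂torusHaar V ≤ G.partitionFnJ J := by
    rw [← integral_const_mul]
    exact integral_mono (hi1.const_mul _) (G.integrable_weightJ J) hline
  have hsplit : ∫ θ, (1 + m - X θ) * G.weightJ J' θ ∂torusHaar V = G.partitionFnJ J' := by
    have hi2 : Integrable (fun θ => X θ * G.weightJ J' θ) (torusHaar V) :=
      integrable_torusHaar_of_continuous (hXc.mul (G.continuous_weightJ J'))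
    have : (fun θ => (1 + m - X θ) * G.weightJ J' θ) =
        fun θ => (1 + m) * G.weightJ J' θ - X θ * G.weightJ J' θ := funext fun θ => by ring
    rw [this, integral_sub ((G.integrable_weightJ J').const_mul _) hi2, integral_const_mul, ← hmean,
      partitionFnJ]
    ring
  rw [hsplit] at hint
  calc G.partitionFnJ J' = Real.exp m * (Real.exp (-m) * G.partitionFnJ J') := by
        rw [← mul_assoc, ← Real.exp_add, add_neg_cancel, Real.exp_zero, one_mul]
    _ ≤ Real.exp m * G.partitionFnJ J := mul_le_mul_of_nonneg_left hint (Real.exp_pos _).le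

/-- **The energy-weighted McBryan–Spencer bound.** For every finite bond system, all real couplings
`J`, every real `φ` and all sites `x, y`:
`⟨cos(θ_x − θ_y)⟩_J ≤ exp(−(φ_x − φ_y) + ∑_a J_a (cosh(φ_{tgt a} − φ_{src a}) − 1) · ⟨cos(θ_{tgt a} − θ_{src a})⟩_{J^φ})`
with `J^φ_a = J_a cosh(φ_{tgt a} − φ_{src a})`: the cost of the complex rotation is weighted by the
bond ENERGIES of the modulated model. [cite: McBryanSpencer1977, main theorem (proof: complex rotation)] -/
theorem expectJ_cosDiff_le_exp_energy :
    G.expectJ J (cosDiff x y) ≤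
      Real.exp (-(φ x - φ y) + ∑ a, J a * (Real.cosh (φ (G.tgt a) - φ (G.src a)) - 1) *
        G.expectJ (G.modCoupling J φ) (reChar (G.bondChar a))) := by
  have hZ := G.partitionFnJ_pos J
  have h1 := G.partitionFnJ_mul_expectJ_cosDiff_le J φ x y
  have h2 := G.partitionFnJ_le_exp_mul_partitionFnJ J (G.modCoupling J φ)
  have hsum : ∑ a, (G.modCoupling J φ a - J a) * G.expectJ (G.modCoupling J φ) (reChar (G.bondChar a)) =
      ∑ a, J a * (Real.cosh (φ (G.tgt a) - φ (G.src a)) - 1) *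
        G.expectJ (G.modCoupling J φ) (reChar (G.bondChar a)) :=
    Finset.sum_congr rfl fun a _ => by rw [modCoupling_apply]; ring
  rw [hsum] at h2
  rw [Real.exp_add]
  refine le_of_mul_le_mul_left ?_ hZ
  calc G.partitionFnJ J * G.expectJ J (cosDiff x y)
      ≤ Real.exp (-(φ x - φ y)) * G.partitionFnJ (G.modCoupling J φ) := h1
    _ ≤ Real.exp (-(φ x - φ y)) * (Real.exp (∑ a, J a * (Real.cosh (φ (G.tgt a) - φ (G.src a)) - 1) *
          G.expectJ (G.modCoupling J φ) (reChar (G.bondChar a))) * G.partitionFnJ J) :=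
        mul_le_mul_of_nonneg_left h2 (Real.exp_pos _).le
    _ = _ := by ring

/-- The same bound for `|⟨cos(θ_x − θ_y)⟩_J|`. [cite: McBryanSpencer1977, main theorem (proof: complex rotation)] -/
theorem abs_expectJ_cosDiff_le_exp_energy :
    |G.expectJ J (cosDiff x y)| ≤
      Real.exp (-(φ x - φ y) + ∑ a, J a * (Real.cosh (φ (G.tgt a) - φ (G.src a)) - 1) *
        G.expectJ (G.modCoupling J φ) (reChar (G.bondChar a))) := by
  have hZ := G.partitionFnJ_pos J
  have h1 := G.partitionFnJ_mul_abs_expectJ_cosDiff_le J φ x y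
  have h2 := G.partitionFnJ_le_exp_mul_partitionFnJ J (G.modCoupling J φ)
  have hsum : ∑ a, (G.modCoupling J φ a - J a) * G.expectJ (G.modCoupling J φ) (reChar (G.bondChar a)) =
      ∑ a, J a * (Real.cosh (φ (G.tgt a) - φ (G.src a)) - 1) *
        G.expectJ (G.modCoupling J φ) (reChar (G.bondChar a)) :=
    Finset.sum_congr rfl fun a _ => by rw [modCoupling_apply]; ring
  rw [hsum] at h2
  rw [Real.exp_add]
  refine le_of_mul_le_mul_left ?_ hZ
  calc G.partitionFnJ J * |G.expectJ J (cosDiff x y)|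
      ≤ Real.exp (-(φ x - φ y)) * G.partitionFnJ (G.modCoupling J φ) := h1
    _ ≤ Real.exp (-(φ x - φ y)) * (Real.exp (∑ a, J a * (Real.cosh (φ (G.tgt a) - φ (G.src a)) - 1) *
          G.expectJ (G.modCoupling J φ) (reChar (G.bondChar a))) * G.partitionFnJ J) :=
        mul_le_mul_of_nonneg_left h2 (Real.exp_pos _).le
    _ = _ := by ring

/-- **Energy-weighted bound with a comparison coupling (Ginibre).** For FERROMAGNETIC couplings
`J ≥ 0` and any coupling array `J̄ ≥ J^φ` (pointwise):
`|⟨cos(θ_x − θ_y)⟩_J| ≤ exp(−(φ_x − φ_y) + ∑_a J_a (cosh(φ_{tgt a} − φ_{src a}) − 1) · ⟨cos(θ_{tgt a} − θ_{src a})⟩_{J̄})`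
(the bond energies are non-decreasing in the couplings, `ginibreExpect_reChar_mono`).
[cite: Ginibre1970, Prop. 3 with Example 4 (plane rotators)] -/
theorem abs_expectJ_cosDiff_le_exp_energy_of_le {J : ι → ℝ} (hJ : ∀ a, 0 ≤ J a) (φ : V → ℝ) (x y : V)
    {Jbar : ι → ℝ} (hle : ∀ a, G.modCoupling J φ a ≤ Jbar a) :
    |G.expectJ J (cosDiff x y)| ≤
      Real.exp (-(φ x - φ y) + ∑ a, J a * (Real.cosh (φ (G.tgt a) - φ (G.src a)) - 1) *
        G.expectJ Jbar (reChar (G.bondChar a))) := by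
  refine (G.abs_expectJ_cosDiff_le_exp_energy J φ x y).trans ?_
  rw [Real.exp_le_exp, add_le_add_iff_left]
  refine Finset.sum_le_sum fun a _ => mul_le_mul_of_nonneg_left ?_ ?_
  · exact G.expectJ_reChar_mono (fun b => (hJ b).trans (G.le_modCoupling hJ φ b)) hle _
  · exact mul_nonneg (hJ a) (sub_nonneg.2 (Real.one_le_cosh _))

/-- **Energy-weighted bound with the uniformly scaled coupling.** For `J ≥ 0` and `φ` with
`|φ_{tgt a} − φ_{src a}| ≤ M` on every bond:
`|⟨cos(θ_x − θ_y)⟩_J| ≤ exp(−(φ_x − φ_y) + ∑_a J_a (cosh(φ_{tgt a} − φ_{src a}) − 1) · ⟨cos(θ_{tgt a} − θ_{src a})⟩_{cosh(M)·J})`.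
[cite: Ginibre1970, Prop. 3 with Example 4 (plane rotators)] -/
theorem abs_expectJ_cosDiff_le_exp_energy_cosh {J : ι → ℝ} (hJ : ∀ a, 0 ≤ J a) {φ : V → ℝ} {M : ℝ}
    (hM : ∀ a, |φ (G.tgt a) - φ (G.src a)| ≤ M) (x y : V) :
    |G.expectJ J (cosDiff x y)| ≤
      Real.exp (-(φ x - φ y) + ∑ a, J a * (Real.cosh (φ (G.tgt a) - φ (G.src a)) - 1) *
        G.expectJ (fun b => Real.cosh M * J b) (reChar (G.bondChar a))) :=
  G.abs_expectJ_cosDiff_le_exp_energy_of_le hJ φ x y (G.modCoupling_le_cosh_mul hJ hM)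

/-- With `⟨cos(∇θ)_a⟩ ≤ 1` the energy-weighted bound returns the McBryan–Spencer a-priori bound
`|⟨cos(θ_x − θ_y)⟩_J| ≤ exp(−(φ_x − φ_y) + ∑_a J_a (cosh(∇φ)_a − 1))` (tree
`BondSystem.abs_expect_cosDiff_le_exp_cosh` for uniform couplings), here for general `J ≥ 0`.
[cite: FriedliVelenik2017, Thm 9.12, display (9.23)] -/
theorem abs_expectJ_cosDiff_le_exp_cosh' {J : ι → ℝ} (hJ : ∀ a, 0 ≤ J a) (φ : V → ℝ) (x y : V) :
    |G.expectJ J (cosDiff x y)| ≤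
      Real.exp (-(φ x - φ y) + ∑ a, J a * (Real.cosh (φ (G.tgt a) - φ (G.src a)) - 1)) := by
  refine (G.abs_expectJ_cosDiff_le_exp_energy J φ x y).trans ?_
  rw [Real.exp_le_exp, add_le_add_iff_left]
  refine Finset.sum_le_sum fun a _ => ?_
  have h0 : 0 ≤ J a * (Real.cosh (φ (G.tgt a) - φ (G.src a)) - 1) :=
    mul_nonneg (hJ a) (sub_nonneg.2 (Real.one_le_cosh _))
  simpa using mul_le_mul_of_nonneg_left (G.expectJ_reChar_bondChar_le_one (G.modCoupling J φ) a) h0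

end Function

end BondSystem

end Literature.Probability.LatticeModels

end
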